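import Summits.ResolutionOfSingularities.ResolutionOfSingularities.Theorems.FrobeniusClosingPatchingRelPerfectDepthPhaseCReachMemberHitOfNDom
import Summits.ResolutionOfSingularities.ResolutionOfSingularities.Theorems.FrobeniusClosingPatchingRelPerfectDepthPhaseCReachNDomDefs
import HarnessLib

/-!
# Crux `PatchingRelPerfect` (stmt-ResolutionOfSingularities-16161), chain W5.2 — F7(β) (β-AX) X3 C-I: the pointwise corollaries of
# `NDominates` BY NAME

[OURS · L1 W5.2 · res-L1-w52-plan-1 RULING G12-23 (2) / G12-27 (B); res-L1-w52-idea-1 NO OBJECTION 20:05:34Z «keep the by-name wrapper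
`NDominates S cyl → …` literally over lead-1΄s `…ReachNDomDefs` decl so that `StepStable (CylReach ∧ NDominates)` and the corollary
consume the same constant»; hand res-L1-w52-stub-2 g6]  Dot-notation wrappers over `ChainW52F7BetaRP.NDominates` (res-L1-w52-lead-1,
`…DepthPhaseCReachNDomDefs`) of the pointwise corollaries of `…DepthPhaseCReachMemberHitOfNDom`:

* `NDominates.memberHitOffZ` — res-L1-w52-idea-1΄s `MemberHitOffZ S cyl` (Sketch v17, unfolded): at every carrier-free point of
  `cosupp K♭` off `range j`, `K♭_x ≤ ⨆_{T ∈ S.𝓔, x ∈ Supp T} T_x` (the (M0) member hit off `cyl.V ⊇ range j` and LEMMA V on `cyl.V ∖ j(Z)`);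
* `NDominates.swallowsAt` — SWALLOWING (c′) off `range j`: a member monomial `𝔑` (an exponent list on `S.𝓔`) with `𝔑_x ≤ K♭_x` and
  `K♭_x = (⨆_{i : (host i)_x ⊄ 𝔪_x²} (host i · monomialIdeal (residualExps i))_x) ⊔ 𝔑_x`.

Def-free, fact-free; nothing here is a statement of the manuscript under review (AI-written; AI review weaker than expert review).

## References

* J. Kollár, *Lectures on Resolution of Singularities* (2007), (3.111) Step 3. [Kollar2007]
* E. Bierstone, D. Grigoriev, P. Milman, J. Włodarczyk, arXiv:1206.3090, §4 Step 2b. [BierstoneGrigorievMilmanWlodarczyk2011]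
-/

-- `Summit.<Summit>.<Sub>.Theorems` with `Sub = Summit` (single-conjunct summit, D-0017)
set_option linter.dupNamespace false

noncomputable section

open CategoryTheory AlgebraicGeometry TopologicalSpace IsLocalRing
open Literature.AlgebraicGeometry.Resolution Scheme.IdealSheafData

namespace Summit.ResolutionOfSingularities.ResolutionOfSingularities.Theorems.ChainW52F7BetaRP

universe u

open DepthMultiHost

variable {X : Scheme.{u}} [IsLocallyNoetherian X] {S : MultiHostState X} {cyl : CylState S}

/-- [OURS · L1 W5.2 · X3 C-I (M0)] **`NDominates S cyl → MemberHitOffZ S cyl`**: at every carrier-free point of the residual cosupport off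
`range j`, the residual stalk lies in the ideal of the members through the point. [cite: Kollar2007, (3.111) Step 3] -/
theorem NDominates.memberHitOffZ (h : NDominates S cyl) :
    ∀ x ∈ (S.residual.K.support : Set X), x ∉ Set.range cyl.j.base →
      (¬ ∃ v ∈ stalkIdeal S.residual.K x, v ∉ (maximalIdeal (X.presheaf.stalk x)) ^ 2) →
      stalkIdeal S.residual.K x ≤
        ⨆ (T : X.IdealSheafData) (_ : T ∈ S.𝓔 ∧ x ∈ (T.support : Set X)), stalkIdeal T x :=
  S.memberHitOffZ_of_nDominates cyl h

/-- [OURS · L1 W5.2 · X3 C-I (c′)] **`NDominates S cyl` ⇒ SWALLOWING off `range j`**: some member monomial `𝔑 = monomialIdeal 𝓡`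
(`𝓡` an exponent list on `S.𝓔`) satisfies `𝔑_x ≤ K♭_x` and `K♭_x = (⨆_{(host i)_x ⊄ 𝔪_x²} termᵢ) ⊔ 𝔑_x` at every `x ∉ range j` — the
terms whose host has order `≥ 2` at `x` are swallowed. [cite: Kollar2007, (3.111) Step 3] -/
theorem NDominates.swallowsAt (h : NDominates S cyl) (x : X) (hxj : x ∉ Set.range cyl.j.base) :
    ∃ 𝓡 : List (X.IdealSheafData × ℕ), boundaryOf 𝓡 = S.𝓔 ∧
      stalkIdeal (monomialIdeal 𝓡) x ≤ stalkIdeal S.residual.K x ∧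
      stalkIdeal S.residual.K x =
        (⨆ (i : Fin S.n) (_ : ¬ stalkIdeal (S.host i) x ≤ (maximalIdeal (X.presheaf.stalk x)) ^ 2),
          stalkIdeal (S.host i * monomialIdeal (S.residualExps i)) x) ⊔ stalkIdeal (monomialIdeal 𝓡) x := by
  obtain ⟨n₀, 𝓝, hbd, hle, hpfx, -, hdom⟩ := h
  have hxZ : x ∉ ((cyl.j.ker).support : Set X) := by rw [S.coe_support_ker_j cyl]; exact hxj
  obtain ⟨h1, h2⟩ := S.swallowsAt_of_nDominatesAt x cyl.j.ker hxZ n₀ 𝓝 hbd hle hpfx fun i hi => hdom i x hi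
  exact ⟨_, map_fst_mapIdx_pair S.𝓔 _, h1, h2⟩

end Summit.ResolutionOfSingularities.ResolutionOfSingularities.Theorems.ChainW52F7BetaRP

end
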